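import Mathlib.Analysis.SpecialFunctions.Log.Basic
import Mathlib.Analysis.SpecialFunctions.Pow.Real
import Literature.NumberTheory.Transcendental.AperyIrrationality
import Summits.KontsevichZagierPeriods.Zeta5Search.Criteria
import HarnessLib

/-!
# ζ(5) search — calibration: Apéry's `ζ(3)` through the typed certificate (cell `pub-zeta5`, TYPER)

HONEST FRAMING: systematic search; no irrationality claim unless certified.

A TEST of the cell's certificate pipeline (`Criteria.lean`), not new mathematics: the calibration
row "Apéry/Beukers `ζ(3)`" of `CRITERIA.md` is turned into an INSTANCE of the structure
`LinearFormCertificate (zetaValue 3)` (criterion C1 with `lcm` denominators, the denominator rate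
coming from the prime number theorem proved in the tree,
`Literature.NumberTheory.Transcendental.eventually_lcmUpto_mul_pow_le_exp`) using ONLY data already
proved in the tree about Apéry's table (`Literature.NumberTheory.Transcendental.Apery…`, after
Rajkumar 2012):

* raw forms `ℓ n = εₙ = q_{n,n} ζ(3) - p_{n,n}` with `0 < εₙ ≤ ζ(3)/q_{n,n}` (`Apery.eps_bounds`);
* denominators `D n = lcm(1..n)³` (`c = (1)`, `k = (3)`, rate `δ = 3` by PNT), no savings
  (`Φ = 1`, `φ = 0`); integrality `q_{n,n} ∈ ℤ`, `lcm(1..n)³ p_{n,n} ∈ ℤ` (`Apery.qT_isInt`,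
  `Apery.lcmUpto_cube_mul_pT_isInt`);
* decay rate `c' = 5 log 2 = log 32` (from `q_{n,n} ≥ 33^{n-62}`, `Apery.pow_mul_qT_le`), and the
  margin inequality `3 < 5 log 2` (`Real.log_two_gt_d9`).

Outcome: `nonempty_linearFormCertificate_zetaValue_three : Nonempty (LinearFormCertificate
(zetaValue 3))` — the certificate format is instantiable with kernel-checked tree data (and an
`example` re-derives `Irrational (zetaValue 3)`, the tree's `Apery.irrational_zeta_three`, in one
line from it); it also fixes the orientation/sign conventions of `CRITERIA.md` (`a n = -d_n³ p`,
`b n = d_n³ q`). Margin used here: `c' + φ' - δ' = 5 log 2 - 31/10 = 0.3657…` (the true margin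
of the family is `4 log(1+√2) - 3 = 0.5255…`).
-/

noncomputable section

open Filter Topology Finset
open Literature.NumberTheory.Transcendental
open Literature.NumberTheory.Transcendental.Apery

namespace Summit.KontsevichZagierPeriods.Zeta5Search

/-- Decay of Apéry's linear forms at rate `log 32`: `|εₙ| ≤ e^{-(5 log 2) n}` for all large `n`
(from `0 < εₙ ≤ ζ(3)/q_{n,n}` and `q_{62+m,62+m} ≥ 33^m`, since `ζ(3)·32⁶² ≤ (33/32)^m`
eventually). -/
theorem eventually_abs_apery_eps_le :
    ∀ᶠ n : ℕ in atTop, |(qT n n : ℝ) * zetaValue 3 - pT n n| ≤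
      Real.exp (-(5 * Real.log 2 * n)) := by
  have hZ := zeta_three_pos
  -- `ζ(3) · 32⁶² ≤ (33/32)^m` for large `m`
  have hgeo : ∀ᶠ m : ℕ in atTop, zetaValue 3 * 32 ^ 62 ≤ ((33 : ℝ) / 32) ^ m :=
    (tendsto_pow_atTop_atTop_of_one_lt (by norm_num : (1 : ℝ) < 33 / 32)).eventually_ge_atTop _
  obtain ⟨M, hM⟩ := eventually_atTop.1 hgeo
  refine eventually_atTop.2 ⟨62 + M, fun n hn => ?_⟩
  obtain ⟨m, rfl⟩ : ∃ m, n = 62 + m := ⟨n - 62, by omega⟩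
  have hm : M ≤ m := by omega
  obtain ⟨hε0, hε1⟩ := eps_bounds (62 + m)
  have hq := qT_pos_real (62 + m) (62 + m)
  -- `33^m ≤ q_{62+m,62+m}`
  have hgrow : (33 : ℝ) ^ m ≤ qT (62 + m) (62 + m) := by
    have h1 : (33 : ℚ) ^ m * qT 62 62 ≤ qT (62 + m) (62 + m) := pow_mul_qT_le m
    have h2 : (1 : ℚ) ≤ qT 62 62 := one_le_qT 62 62
    have h3 : (33 : ℚ) ^ m ≤ qT (62 + m) (62 + m) :=
      le_trans (le_mul_of_one_le_right (by positivity) h2) h1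
    exact_mod_cast h3
  -- the exponential is `32^{-(62+m)}`
  have hexp : Real.exp (-(5 * Real.log 2 * ((62 + m : ℕ) : ℝ))) = ((32 : ℝ) ^ (62 + m))⁻¹ := by
    rw [Real.exp_neg, show (5 : ℝ) * Real.log 2 * ((62 + m : ℕ) : ℝ) =
      ((5 * (62 + m) : ℕ) : ℝ) * Real.log 2 by push_cast; ring, Real.exp_nat_mul,
      Real.exp_log two_pos, pow_mul]
    norm_num
  rw [abs_of_pos hε0, hexp]
  calc (qT (62 + m) (62 + m) : ℝ) * zetaValue 3 - pT (62 + m) (62 + m)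
      ≤ zetaValue 3 / qT (62 + m) (62 + m) := hε1
    _ ≤ zetaValue 3 / (33 : ℝ) ^ m := by gcongr
    _ ≤ ((32 : ℝ) ^ (62 + m))⁻¹ := by
        rw [div_le_iff₀ (by positivity), pow_add]
        have h := hM m hm
        rw [div_pow, le_div_iff₀ (by positivity)] at h
        have e : ((32 : ℝ) ^ 62 * 32 ^ m)⁻¹ * 33 ^ m = (33 : ℝ) ^ m / (32 ^ 62 * 32 ^ m) := by
          ring
        rw [e, le_div_iff₀ (by positivity)]
        linarith

/-- **Apéry's data instantiate the cell's certificate** (calibration of `CRITERIA.md`, row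
"Apéry/Beukers `ζ(3)`"): the structure `LinearFormCertificate (zetaValue 3)` is inhabited, with
`ℓ n = εₙ = q_{n,n} ζ(3) - p_{n,n}`, `D n = lcm(1..n)³`, `Φ = 1`, `a n = -lcm(1..n)³ p_{n,n}`,
`b n = lcm(1..n)³ q_{n,n}`, decay rate `c' = 5 log 2`, denominator rate `δ' = 31/10` (any
`δ' > 3` works, PNT), savings rate `φ' = 0`, margin `31/10 < 5 log 2`. (Stated as `Nonempty`, not
as `Irrational (zetaValue 3)`: that conclusion is the tree's `Apery.irrational_zeta_three`; see the
`example` below for the one-line derivation through `LinearFormCertificate.irrational`.) -/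
theorem nonempty_linearFormCertificate_zetaValue_three :
    Nonempty (LinearFormCertificate (zetaValue 3)) := by
  classical
  -- integer data: `q_{n,n} = Q n`, `lcm(1..n)³ p_{n,n} = P n`
  have hQ : ∀ n : ℕ, ∃ z : ℤ, qT n n = z := fun n => qT_isInt n n
  have hP : ∀ n : ℕ, ∃ z : ℤ, (Nat.lcmUpto n : ℚ) ^ 3 * pT n n = z := fun n =>
    lcmUpto_cube_mul_pT_isInt n n n le_rfl le_rfl
  choose Q hQ using hQ
  choose P hP using hP
  refine ⟨{ form := fun n => (qT n n : ℝ) * zetaValue 3 - pT n n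
            denom := fun n => Nat.lcmUpto n ^ 3
            saving := fun _ => 1
            coeffConst := fun n => -P n
            coeffXi := fun n => (Nat.lcmUpto n : ℤ) ^ 3 * Q n
            decayRate := 5 * Real.log 2
            denomRate := 31 / 10
            savingRate := 0
            denom_pos := fun n => pow_pos (Nat.lcmUpto_pos n) 3
            saving_pos := fun _ => one_pos
            arith := ?_
            decay := eventually_abs_apery_eps_le
            denom_le := ?_
            le_saving := ?_
            nonvanishing := ?_
            margin_pos := ?_ }⟩
  · -- arithmetic: `d_n³ εₙ = 1 · (-P n + d_n³ Q n · ζ(3))`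
    filter_upwards with n
    have hQr : ((qT n n : ℚ) : ℝ) = (Q n : ℝ) := by rw [hQ n]; exact Rat.cast_intCast _
    have hPr : (Nat.lcmUpto n : ℝ) ^ 3 * ((pT n n : ℚ) : ℝ) = (P n : ℝ) := by
      have h := congrArg (Rat.cast : ℚ → ℝ) (hP n)
      push_cast at h
      exact h
    push_cast
    rw [← hPr, hQr]
    ring
  · -- denominators: `d_n³ ≤ e^{(3 + 1/10) n}` for large `n` (prime number theorem, in the tree)
    filter_upwards [eventually_lcmUpto_mul_pow_le_exp 1 3 (by norm_num : (0 : ℝ) < 1 / 10)]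
      with n hn
    push_cast
    simp only [one_mul, Nat.cast_one] at hn
    convert hn using 2
    norm_num
  · -- savings `Φ = 1`: `e^{0·n} ≤ 1`
    filter_upwards with n
    simp
  · -- non-vanishing: `εₙ > 0`
    exact Eventually.frequently (Eventually.of_forall fun n => (eps_bounds n).1.ne')
  · -- margin: `31/10 < 5 log 2 + 0`
    have := Real.log_two_gt_d9
    linarith

/-- The one-line use of the certificate: `ζ(3) ∉ ℚ` (the tree's `Apery.irrational_zeta_three`,
re-derived through `LinearFormCertificate.irrational`; an `example`, not a new declaration). -/
example : Irrational (zetaValue 3) :=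
  (Classical.choice nonempty_linearFormCertificate_zetaValue_three).irrational

end Summit.KontsevichZagierPeriods.Zeta5Search
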